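import Mathlib
import HarnessLib
import Summits.NavierStokesRegularity.NavierStokesRegularity.Theorems.TaylorModelRungThreeCertificateIntervalDJets

/-!
# Crux K1b-DR (stmt-NavierStokesRegularity-23954), line `taylor-model` — certificate SOUNDNESS tooling: INTERVAL JETS, part 2 —
# the ARRAY-MATERIALISED interval jets `jetLevelsA` and their enclosure theorem (S1-VECTOR-23954 §3 (B); dss_58 (A)/(B))

Part 1 (`…IntervalDJets`) proved abstractly that any family of boxes closed under the rounded interval evaluation of the
Cauchy-product recursion encloses the Taylor jets of every point of the initial box. This part gives the EXECUTABLE family the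
checker runs: coordinates are numbered `c < n`, a coordinate box vector is an `Array IntervalD` of size `n` read by `aget` (junk
`ofInt 0` beyond the size — readers only look below `n`), a table of levels is an `Array (Array IntervalD)` read by `lget`; tables
are built bottom-up by the generic `buildLevels step D` (level `0 = D`, level `k+1 = step k (levels 0..k)`, each level computed
ONCE — prefix-stable, `lget_buildLevels_of_le`); the interval twin of the field is any
`QBA : Array IntervalD → Array IntervalD → Array IntervalD` with ONE soundness hypothesis (`IsFieldEnclosureA`); the jet step
`jetStepA n QBA prec k Ls` forms the `k+1` products `QBA Ls[m] Ls[k-m]` once and then, per coordinate `c < n`,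
`divNat prec (rangeSumR prec (m ↦ prods[m][c]) (k+1)) (k+1)`; `jetLevelsA n QBA prec Y := buildLevels (jetStepA n QBA prec) Y`.
Function forms `fnField`, `fnLevels` connect to part 1 (`isFieldEnclosure_fnField`, `isJetEnclosure_jetLevelsA` — structural).
Main result `mem_jet_of_jetLevelsA`: for states read through `rd : V → ℕ → ℝ` with jets obeying the recursion on the coordinates
`< n`, `rd y c ∈ Y[c]` (`c < n`) implies `rd (T y k) c ∈ (jetLevelsA n QBA prec Y K)[k][c]` for all `k ≤ K`, `c < n`.

MODEL-lattice bookkeeping only (rung TL-M3, one finite-dimensional model ODE); nothing here concerns the Navier–Stokes equations.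
-/

-- the sub-problem namespace repeats the summit name by design (D-0017)
set_option linter.dupNamespace false

namespace Summit.NavierStokesRegularity.NavierStokesRegularity.Theorems.TaylorModelCert

open scoped BigOperators

namespace IntervalD

/-! ### Array readers -/

/-- Coordinate `c` of an interval vector (junk `ofInt 0` beyond the size). [folklore] -/
def aget (A : Array IntervalD) (c : ℕ) : IntervalD := if h : c < A.size then A[c] else ofInt 0

/-- Level `k` of a table of interval vectors (junk `#[]` beyond the size). [folklore] -/
def lget (Ls : Array (Array IntervalD)) (k : ℕ) : Array IntervalD := if h : k < Ls.size then Ls[k] else #[]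

/-- `aget` of `Array.ofFn`. [folklore] -/
theorem aget_ofFn {n : ℕ} (f : Fin n → IntervalD) {c : ℕ} (hc : c < n) : aget (Array.ofFn f) c = f ⟨c, hc⟩ := by
  unfold aget
  rw [dif_pos (by rw [Array.size_ofFn]; exact hc), Array.getElem_ofFn]

/-- `lget` of `Array.ofFn`. [folklore] -/
theorem lget_ofFn {K : ℕ} (F : Fin K → Array IntervalD) {k : ℕ} (hk : k < K) : lget (Array.ofFn F) k = F ⟨k, hk⟩ := by
  unfold lget
  rw [dif_pos (by rw [Array.size_ofFn]; exact hk), Array.getElem_ofFn]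

/-- An array of size `n` is `Array.ofFn` of its reader. [folklore] -/
theorem ofFn_aget {n : ℕ} {A : Array IntervalD} (hA : A.size = n) : (Array.ofFn fun c : Fin n => aget A c) = A := by
  apply Array.ext
  · rw [Array.size_ofFn, hA]
  · intro i hi₁ hi₂
    rw [Array.getElem_ofFn]
    unfold aget
    rw [dif_pos hi₂]

/-- `lget` below the size of a `push` reads the old table. [folklore] -/
theorem lget_push_lt {Ls : Array (Array IntervalD)} {A : Array IntervalD} {k : ℕ} (hk : k < Ls.size) :
    lget (Ls.push A) k = lget Ls k := by
  unfold lget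
  rw [dif_pos (by rw [Array.size_push]; omega), dif_pos hk, Array.getElem_push_lt]

/-- `lget` at the size of a `push` reads the pushed entry. [folklore] -/
theorem lget_push_eq {Ls : Array (Array IntervalD)} {A : Array IntervalD} : lget (Ls.push A) Ls.size = A := by
  unfold lget
  rw [dif_pos (by rw [Array.size_push]; omega), Array.getElem_push_eq]

/-- `rangeSumR` only depends on the summands below the bound. [folklore] -/
theorem rangeSumR_congr (prec : ℕ) {f g : ℕ → IntervalD} : ∀ k, (∀ m < k, f m = g m) →
    rangeSumR prec f k = rangeSumR prec g k
  | 0, _ => rfl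
  | k + 1, h => by
    simp only [rangeSumR]
    rw [rangeSumR_congr prec k fun m hm => h m (Nat.lt_succ_of_lt hm), h k (Nat.lt_succ_self k)]

/-! ### Bottom-up tables of levels -/

/-- Generic bottom-up table: level `0 = D`, level `k+1 = step k (levels 0..k)` (each level computed once). [folklore] -/
def buildLevels (step : ℕ → Array (Array IntervalD) → Array IntervalD) (D : Array IntervalD) : ℕ → Array (Array IntervalD)
  | 0 => #[D]
  | k + 1 =>
    let Ls := buildLevels step D k
    Ls.push (step k Ls)

section Build

variable (step : ℕ → Array (Array IntervalD) → Array IntervalD) (D : Array IntervalD)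

/-- The table of levels `0..K` has `K+1` entries. [folklore] -/
theorem size_buildLevels : ∀ K, (buildLevels step D K).size = K + 1
  | 0 => rfl
  | K + 1 => by simp only [buildLevels, Array.size_push, size_buildLevels K]

/-- Raising the order does not change the lower levels. [folklore] -/
theorem lget_buildLevels_of_le : ∀ {K k : ℕ}, k ≤ K → lget (buildLevels step D K) k = lget (buildLevels step D k) k
  | 0, k, hk => by rw [Nat.le_zero.1 hk]
  | K + 1, k, hk => by
    rcases Nat.lt_or_eq_of_le hk with h | h
    · have hs : k < (buildLevels step D K).size := by rw [size_buildLevels]; omega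
      simp only [buildLevels]
      rw [lget_push_lt hs]
      exact lget_buildLevels_of_le (Nat.le_of_lt_succ h)
    · rw [h]

/-- Level `0` is the initial box. [folklore] -/
theorem lget_buildLevels_zero (K : ℕ) : lget (buildLevels step D K) 0 = D := by
  rw [lget_buildLevels_of_le step D (Nat.zero_le K)]
  unfold lget
  simp [buildLevels]

/-- The top level `k+1` is the freshly computed array. [folklore] -/
theorem lget_buildLevels_succ (k : ℕ) : lget (buildLevels step D (k + 1)) (k + 1) = step k (buildLevels step D k) := by
  have hs : (buildLevels step D k).size = k + 1 := size_buildLevels step D k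
  simp only [buildLevels]
  rw [← hs, lget_push_eq]

/-- All levels are arrays of size `n` if the initial box and every step output are. [folklore] -/
theorem size_lget_buildLevels {n : ℕ} (hD : D.size = n) (hstep : ∀ k Ls, (step k Ls).size = n) :
    ∀ {K k : ℕ}, k ≤ K → (lget (buildLevels step D K) k).size = n := by
  intro K k hk
  rw [lget_buildLevels_of_le step D hk]
  cases k with
  | zero => rw [lget_buildLevels_zero]; exact hD
  | succ k => rw [lget_buildLevels_succ, hstep]

end Build

/-! ### Function forms -/

/-- Function form (at `σ = Fin n`) of an array-coded interval field. [folklore] -/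
def fnField (n : ℕ) (QBA : Array IntervalD → Array IntervalD → Array IntervalD) :
    (Fin n → IntervalD) → (Fin n → IntervalD) → Fin n → IntervalD :=
  fun U W c => aget (QBA (Array.ofFn U) (Array.ofFn W)) c

/-- Function form (at `σ = Fin n`) of a table of levels. [folklore] -/
def fnLevels (n : ℕ) (Ls : Array (Array IntervalD)) : ℕ → Fin n → IntervalD := fun k c => aget (lget Ls k) c

/-- A level of size `n` is `Array.ofFn` of its function form. [folklore] -/
theorem ofFn_fnLevels {n : ℕ} {Ls : Array (Array IntervalD)} {k : ℕ} (h : (lget Ls k).size = n) :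
    Array.ofFn (fnLevels n Ls k) = lget Ls k :=
  ofFn_aget h

/-! ### The materialised interval jets -/

/-- The JET STEP on arrays: level `k+1` from the table `Ls` of the levels `0..k` — the `k+1` products `QBA Ls[m] Ls[k-m]` are
formed ONCE, then per coordinate `c < n` the rounded sum is divided by `k+1`. [folklore] -/
def jetStepA (n : ℕ) (QBA : Array IntervalD → Array IntervalD → Array IntervalD) (prec : ℕ) (k : ℕ)
    (Ls : Array (Array IntervalD)) : Array IntervalD :=
  let prods : Array (Array IntervalD) := Array.ofFn fun m : Fin (k + 1) => QBA (lget Ls m) (lget Ls (k - m))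
  Array.ofFn fun c : Fin n => divNat prec (rangeSumR prec (fun m => aget (lget prods m) c) (k + 1)) (k + 1)

/-- **Interval jets, materialised**: the table of the levels `0..K` over the initial box `Y`. [folklore] -/
def jetLevelsA (n : ℕ) (QBA : Array IntervalD → Array IntervalD → Array IntervalD) (prec : ℕ) (Y : Array IntervalD) :
    ℕ → Array (Array IntervalD) :=
  buildLevels (jetStepA n QBA prec) Y

/-- Jet-step outputs have size `n`. [folklore] -/
theorem size_jetStepA (n : ℕ) (QBA : Array IntervalD → Array IntervalD → Array IntervalD) (prec k : ℕ)
    (Ls : Array (Array IntervalD)) : (jetStepA n QBA prec k Ls).size = n := by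
  simp only [jetStepA, Array.size_ofFn]

/-- Raising the order does not change the lower levels of `jetLevelsA`. [folklore] -/
theorem lget_jetLevelsA_of_le (n : ℕ) (QBA : Array IntervalD → Array IntervalD → Array IntervalD) (prec : ℕ)
    (Y : Array IntervalD) {K k : ℕ} (hk : k ≤ K) : lget (jetLevelsA n QBA prec Y K) k = lget (jetLevelsA n QBA prec Y k) k :=
  lget_buildLevels_of_le _ Y hk

/-- Level `0` of `jetLevelsA` is the initial box. [folklore] -/
theorem lget_jetLevelsA_zero (n : ℕ) (QBA : Array IntervalD → Array IntervalD → Array IntervalD) (prec : ℕ)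
    (Y : Array IntervalD) (K : ℕ) : lget (jetLevelsA n QBA prec Y K) 0 = Y :=
  lget_buildLevels_zero _ Y K

/-- The top level of `jetLevelsA … (k+1)` is the jet step applied to the order-`k` table. [folklore] -/
theorem lget_jetLevelsA_succ (n : ℕ) (QBA : Array IntervalD → Array IntervalD → Array IntervalD) (prec : ℕ)
    (Y : Array IntervalD) (k : ℕ) :
    lget (jetLevelsA n QBA prec Y (k + 1)) (k + 1) = jetStepA n QBA prec k (jetLevelsA n QBA prec Y k) :=
  lget_buildLevels_succ _ Y k

/-- The levels of `jetLevelsA` have size `n` (given `Y.size = n`). [folklore] -/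
theorem size_lget_jetLevelsA (n : ℕ) (QBA : Array IntervalD → Array IntervalD → Array IntervalD) (prec : ℕ)
    {Y : Array IntervalD} (hY : Y.size = n) {K k : ℕ} (hk : k ≤ K) : (lget (jetLevelsA n QBA prec Y K) k).size = n :=
  size_lget_buildLevels _ Y hY (size_jetStepA n QBA prec) hk

section Sound

variable {V : Type*} (rd : V → ℕ → ℝ) (Q : V → V → V) (n : ℕ)

/-- `QBA` is an interval extension of `Q` on arrays of size `n`: coordinate boxes (below `n`) of the arguments in ⇒ each
coordinate `c < n` of `Q u w` lies in `(QBA A B)[c]`. [folklore] -/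
def IsFieldEnclosureA (QBA : Array IntervalD → Array IntervalD → Array IntervalD) : Prop :=
  ∀ (A B : Array IntervalD) (u w : V), A.size = n → B.size = n →
    (∀ c < n, mem (rd u c) (aget A c)) → (∀ c < n, mem (rd w c) (aget B c)) → ∀ c < n, mem (rd (Q u w) c) (aget (QBA A B) c)

variable {rd Q n}

/-- The function form of a sound array field is an interval extension (part 1's `IsFieldEnclosure` at `σ = Fin n`). [folklore] -/
theorem isFieldEnclosure_fnField {QBA : Array IntervalD → Array IntervalD → Array IntervalD} (hQBA : IsFieldEnclosureA rd Q n QBA) :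
    IsFieldEnclosure (fun (x : V) (c : Fin n) => rd x c) Q (fnField n QBA) := by
  intro U W u w hu hw c
  show mem (rd (Q u w) c) (aget (QBA (Array.ofFn U) (Array.ofFn W)) c)
  refine hQBA (Array.ofFn U) (Array.ofFn W) u w Array.size_ofFn Array.size_ofFn ?_ ?_ c c.isLt
  · intro c' hc'; rw [aget_ofFn U hc']; exact hu ⟨c', hc'⟩
  · intro c' hc'; rw [aget_ofFn W hc']; exact hw ⟨c', hc'⟩

/-- **The materialised levels form a jet enclosure** for the function form of the field (structural: no soundness hypothesis).
[folklore] -/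
theorem isJetEnclosure_jetLevelsA (QBA : Array IntervalD → Array IntervalD → Array IntervalD) (prec K : ℕ)
    {Y : Array IntervalD} (hY : Y.size = n) :
    IsJetEnclosure (fnField n QBA) prec K (fnLevels n (jetLevelsA n QBA prec Y K)) := by
  intro k hk c x hx
  -- level `k+1` of the order-`K` table is the jet step applied to the order-`k` table
  have hlev : aget (lget (jetLevelsA n QBA prec Y K) (k + 1)) c =
      jetStep (fnField n QBA) prec (fnLevels n (jetLevelsA n QBA prec Y K)) k c := by
    simp only [jetStep, fnField]
    rw [lget_jetLevelsA_of_le n QBA prec Y (Nat.succ_le_of_lt hk), lget_jetLevelsA_succ]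
    simp only [jetStepA]
    rw [aget_ofFn _ c.isLt]
    congr 1
    refine rangeSumR_congr prec (k + 1) fun m hm => ?_
    have hm' : m ≤ K := by omega
    have hkm : k - m ≤ K := by omega
    have e1 : lget (jetLevelsA n QBA prec Y k) m = lget (jetLevelsA n QBA prec Y K) m := by
      rw [lget_jetLevelsA_of_le n QBA prec Y hm', lget_jetLevelsA_of_le n QBA prec Y (Nat.le_of_lt_succ hm)]
    have e2 : lget (jetLevelsA n QBA prec Y k) (k - m) = lget (jetLevelsA n QBA prec Y K) (k - m) := by
      rw [lget_jetLevelsA_of_le n QBA prec Y hkm, lget_jetLevelsA_of_le n QBA prec Y (Nat.sub_le k m)]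
    rw [lget_ofFn _ hm, e1, e2, ofFn_fnLevels (size_lget_jetLevelsA n QBA prec hY hm'),
      ofFn_fnLevels (size_lget_jetLevelsA n QBA prec hY hkm)]
  show mem x (aget (lget (jetLevelsA n QBA prec Y K) (k + 1)) c)
  rw [hlev]; exact hx

/-- **The materialised interval jets enclose the jets** of every state whose coordinates lie in the initial box:
`rd (T y k) c ∈ (jetLevelsA n QBA prec Y K)[k][c]` for `k ≤ K`, `c < n`. [folklore; cite: Moore 1966 Ch. 3;
Nedialkov–Jackson–Corliss 1999 §3] -/
theorem mem_jet_of_jetLevelsA {T : V → ℕ → V} (hT0 : ∀ x, ∀ c < n, rd (T x 0) c = rd x c)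
    (hTs : ∀ x (k : ℕ), ∀ c < n, ((k : ℝ) + 1) * rd (T x (k + 1)) c =
      ∑ i ∈ Finset.range (k + 1), rd (Q (T x i) (T x (k - i))) c)
    {QBA : Array IntervalD → Array IntervalD → Array IntervalD} (hQBA : IsFieldEnclosureA rd Q n QBA)
    (prec K : ℕ) {Y : Array IntervalD} (hY : Y.size = n) {y : V} (hy : ∀ c < n, mem (rd y c) (aget Y c)) :
    ∀ k ≤ K, ∀ c < n, mem (rd (T y k) c) (aget (lget (jetLevelsA n QBA prec Y K) k) c) := by
  have hy' : ∀ c : Fin n, mem (rd y c) (fnLevels n (jetLevelsA n QBA prec Y K) 0 c) := fun c => by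
    simp only [fnLevels]
    rw [lget_jetLevelsA_zero]; exact hy c c.isLt
  intro k hk c hc
  exact mem_jet_of_isJetEnclosure (rd := fun (x : V) (c : Fin n) => rd x c) (Q := Q) (T := T)
    (fun x c => hT0 x c c.isLt) (fun x k c => hTs x k c c.isLt) (isFieldEnclosure_fnField hQBA)
    (isJetEnclosure_jetLevelsA QBA prec K hY) hy' k hk ⟨c, hc⟩

end Sound

end IntervalD

end Summit.NavierStokesRegularity.NavierStokesRegularity.Theorems.TaylorModelCert
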